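import Literature.Probability.Percolation.SharpnessDCTProofs
import Literature.Probability.Percolation.QSMPolynomials
import HarnessLib

/-!
# The isolation surgery: closure argument and descent
(`stub_locModScheme` of line `locmod`, crux `CriticalCurveRegular`, stmt-CriticalPhenomena-16065 — part 2)

Two percolation-free ingredients of the local modification (idea `isolation-descent`):

* `notMem_siteToBoundary_of_closed` — **closure**: if a set of sites `M ∋ 0` missing `∂Λ_n` is
  closed under the open bonds of `ω` inside `Λ_n`, then `ω ∉ {0 ↔ ∂Λ_n}`;
* `isolation_notMem` — the closure set of the surgery: for `ω' ∉ {0 ↔ ∂Λ_n}`, window bonds `W`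
  touching `Q`, a site `a ∈ Q` off `∂Λ_n`, and extra bonds each of which either has all its
  endpoints in `M := C' ∪ {a}` (`C'` = the `0`-cluster of `ω' ∖ W`) or none, the configuration
  `(ω' ∖ W) ∪ extras` is not in `{0 ↔ ∂Λ_n}`;
* `descent` — for ANY event `A` and finite sets `S ∉ A`, `S ∪ T ∈ A`: adding the elements of `T`
  one at a time, the step that enters `A` exhibits `f ∈ T` and `S ⊆ S'' ⊆ S ∪ T` with `f ∉ S''`,
  `insert f S'' ∈ A`, `S'' ∉ A` (so `f` is pivotal in `S''` when `A` is increasing).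

References: Grimmett, *Percolation* (1999), §3.3 (3.12); Balister–Bollobás–Riordan,
arXiv:1402.0834, §2 Claim (cl1) ("delete points one-by-one … the last one deleted is pivotal").
-/

noncomputable section

open Set
open Literature.Probability.Percolation Literature.Probability.LatticeModels

namespace Summit.CriticalPhenomena.PercolationContinuityZ3.Cruxes.CriticalCurveRegular.Locmod

namespace Isolation

/-! ## Closure -/

/-- **Closure.** If `M` contains `0`, misses `∂Λ_n`, and is closed under the open bonds of `ω`
inside `Λ_n` (an open bond from a site of `M` to a site of `Λ_n` ends in `M`), then `0` is not
joined to `∂Λ_n` in `ω` inside `Λ_n`. -/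
theorem notMem_siteToBoundary_of_closed {n : ℕ} {ω : Set (Sym2 (Site 3))} (M : Set (Site 3))
    (h0 : (0 : Site 3) ∈ M) (hM : ∀ y ∈ M, y ∉ innerBoundary (zdGraph 3) (box 3 n))
    (hcl : ∀ y y' : Site 3, y ∈ M → y' ∈ box 3 n → s(y, y') ∈ ω → y ≠ y' → y' ∈ M) :
    ω ∉ siteToBoundary 3 n := by
  intro h
  rw [DCT16.mem_siteToBoundary_iff] at h
  obtain ⟨z, hz, hpath⟩ := h
  have hzM : z ∈ M := by
    refine DCT16.pathIn_induction (fun w => w ∈ M) hpath h0 fun a b _ hb ha hab => ?_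
    rw [openGraph_adj] at hab
    exact hcl a b ha hb hab.1 hab.2
  exact hM z hzM hz

/-- **The closure set of the isolation surgery.** Let `ω' ⊆ E(ℤ³)` with `ω' ∉ {0 ↔ ∂Λ_n}`, `Q` a
window with bonds `W = edgesTouching (zdGraph 3) Q`, `a ∈ Q` a site off `∂Λ_n` such that every
site of the `0`-cluster `C'` of `ω' ∖ W` (inside `Λ_n`) lying in `Q` equals `a`, and `X` a set of
extra bonds each of which has either all or none of its endpoints in `M = C' ∪ {a}`. Then
`(ω' ∖ W) ∪ X ∉ {0 ↔ ∂Λ_n}`. -/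
theorem isolation_notMem {n : ℕ} {ω' : Set (Sym2 (Site 3))} (hω : ω' ⊆ (zdGraph 3).edgeSet)
    (hout : ω' ∉ siteToBoundary 3 n) (Q : Finset (Site 3)) {a : Site 3} (haQ : a ∈ Q)
    (ha : a ∉ innerBoundary (zdGraph 3) (box 3 n))
    (hCQ : ∀ y, PathIn (openGraph (ω' \ ↑(edgesTouching (zdGraph 3) Q))) ↑(box 3 n) 0 y →
      y ∈ Q → y = a)
    (X : Set (Sym2 (Site 3)))
    (hXM : ∀ g ∈ X, (∀ y ∈ g, PathIn (openGraph (ω' \ ↑(edgesTouching (zdGraph 3) Q))) ↑(box 3 n) 0 y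
        ∨ y = a) ∨ (∀ y ∈ g, ¬ (PathIn (openGraph (ω' \ ↑(edgesTouching (zdGraph 3) Q))) ↑(box 3 n) 0 y
        ∨ y = a))) :
    (ω' \ ↑(edgesTouching (zdGraph 3) Q)) ∪ X ∉ siteToBoundary 3 n := by
  set W : Set (Sym2 (Site 3)) := ↑(edgesTouching (zdGraph 3) Q) with hW
  set M : Set (Site 3) := {y | PathIn (openGraph (ω' \ W)) ↑(box 3 n) 0 y ∨ y = a} with hMdef
  by_cases h0Λ : (0 : Site 3) ∈ box 3 n
  swap
  · -- degenerate: `0 ∉ Λ_n` (never happens for boxes, but then there is no path at all)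
    intro h
    rw [DCT16.mem_siteToBoundary_iff] at h
    obtain ⟨z, -, hpath⟩ := h
    exact h0Λ hpath.left_mem
  refine notMem_siteToBoundary_of_closed M (Or.inl (PathIn.refl (Finset.mem_coe.2 h0Λ))) ?_ ?_
  · -- `M` misses the boundary: `C' ⊆ C` misses it since `ω' ∉ A`, and `a` is off it
    rintro y (hy | rfl) hyb
    · refine hout (DCT16.mem_siteToBoundary_iff.2 ⟨y, hyb, hy.mono_graph fun u v huv => ?_⟩)
      rw [openGraph_adj] at huv ⊢
      exact ⟨huv.1.1, huv.2⟩
    · exact ha hyb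
  · -- closure under the open bonds of `(ω' ∖ W) ∪ X`
    intro y y' hy hy' hg hne
    rcases hg with ⟨hgω, hgW⟩ | hgX
    · -- a bond of `ω' ∖ W`: it does not touch `Q`, so `y ≠ a`… unless `y ∉ Q`; in all cases
      -- `y ∈ C'` (if `y = a ∈ Q` the bond would touch `Q`), and then `y' ∈ C'`
      have hyC : PathIn (openGraph (ω' \ W)) ↑(box 3 n) 0 y := by
        rcases hy with hy | rfl
        · exact hy
        · exact absurd (mem_edgesTouching_iff.2 ⟨hω hgω, y, haQ, Sym2.mem_mk_left _ _⟩) hgW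
      exact Or.inl (hyC.tail ((openGraph_adj _ y y').2 ⟨⟨hgω, hgW⟩, hne⟩) hy')
    · rcases hXM _ hgX with hall | hnone
      · exact hall y' (Sym2.mem_mk_right y y')
      · exact absurd hy (hnone y (Sym2.mem_mk_left y y'))

/-! ## Descent -/

/-- **Descent.** For any event `A` on subsets of `ι` and finite `S, T` with `↑S ∉ A` and
`↑(S ∪ T) ∈ A`, some `f ∈ T` and `S''` with `S ⊆ S'' ⊆ S ∪ T`, `f ∉ S''` satisfy
`insert f ↑S'' ∈ A` and `↑S'' ∉ A`. -/
theorem descent {ι : Type*} [DecidableEq ι] (A : Set (Set ι)) (T : Finset ι) :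
    ∀ S : Finset ι, (↑S : Set ι) ∉ A → (↑(S ∪ T) : Set ι) ∈ A →
      ∃ S'' : Finset ι, ∃ f ∈ T, S ⊆ S'' ∧ S'' ⊆ S ∪ T ∧ f ∉ S'' ∧
        insert f (↑S'' : Set ι) ∈ A ∧ (↑S'' : Set ι) ∉ A := by
  induction T using Finset.induction_on with
  | empty =>
    intro S h0 h1
    rw [Finset.union_empty] at h1
    exact absurd h1 h0
  | @insert g T hg ih =>
    intro S h0 h1
    by_cases hgS : g ∈ S
    · -- `g` already present: nothing changes at this step
      have heq : S ∪ insert g T = S ∪ T := by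
        rw [Finset.union_insert, Finset.insert_eq_of_mem (Finset.mem_union_left T hgS)]
      rw [heq] at h1
      obtain ⟨S'', f, hf, h2, h3, h4, h5, h6⟩ := ih S h0 h1
      exact ⟨S'', f, Finset.mem_insert_of_mem hf, h2,
        h3.trans (Finset.union_subset_union le_rfl (Finset.subset_insert g T)), h4, h5, h6⟩
    · by_cases hA : (↑(insert g S) : Set ι) ∈ A
      · -- the step `S ↦ insert g S` enters `A`: `g` is the pivotal element
        refine ⟨S, g, Finset.mem_insert_self g T, le_rfl, Finset.subset_union_left, hgS, ?_, h0⟩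
        rwa [Finset.coe_insert] at hA
      · -- otherwise continue from `insert g S`
        have h1' : (↑(insert g S ∪ T) : Set ι) ∈ A := by
          rwa [Finset.insert_union, ← Finset.union_insert]
        obtain ⟨S'', f, hf, h2, h3, h4, h5, h6⟩ := ih (insert g S) hA h1'
        refine ⟨S'', f, Finset.mem_insert_of_mem hf, (Finset.subset_insert g S).trans h2, ?_, h4,
          h5, h6⟩
        rw [Finset.insert_union, ← Finset.union_insert] at h3
        exact h3

/-- **Descent to a pivotal coordinate of an increasing event.** -/
theorem descent_isPivotal {ι : Type*} [DecidableEq ι] {A : Set (Set ι)} (hA : IsUpperSet A)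
    {S T : Finset ι} (h0 : (↑S : Set ι) ∉ A) (h1 : (↑(S ∪ T) : Set ι) ∈ A) :
    ∃ S'' : Finset ι, ∃ f ∈ T, S ⊆ S'' ∧ S'' ⊆ S ∪ T ∧ IsPivotal A f (↑S'' : Set ι) := by
  obtain ⟨S'', f, hf, h2, h3, h4, h5, h6⟩ := descent A T S h0 h1
  refine ⟨S'', f, hf, h2, h3, ?_⟩
  rw [ProdWeight.isPivotal_iff_of_upper hA]
  refine ⟨h5, ?_⟩
  rwa [Set.sdiff_singleton_eq_self (by simpa using h4)]

end Isolation

/-! ## Registered export -/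

/-- **Closure (registered helper signature of this file; = `Isolation.notMem_siteToBoundary_of_closed`
with explicit binders).** -/
theorem locMod_isolation_main :
    ∀ (n : ℕ) (ω : Set (Sym2 (Site 3))) (M : Set (Site 3)),
      (0 : Site 3) ∈ M → (∀ y ∈ M, y ∉ innerBoundary (zdGraph 3) (box 3 n)) →
      (∀ y y' : Site 3, y ∈ M → y' ∈ box 3 n → s(y, y') ∈ ω → y ≠ y' → y' ∈ M) →
      ω ∉ siteToBoundary 3 n :=
  fun _ _ M h0 hM hcl => Isolation.notMem_siteToBoundary_of_closed M h0 hM hcl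

end Summit.CriticalPhenomena.PercolationContinuityZ3.Cruxes.CriticalCurveRegular.Locmod

end
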